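import Summits.CriticalPhenomena.SAWScalingLimit.Theses.SAWCompassLattice
import Literature.Probability.RandomPlanarGeometry.PortGadgetLattice

/-!
# Stub `stub_surfaceUniversality` (line `Sketch`, crux `HexTransfer`, stmt-CriticalPhenomena-14221):
# the compass side of `SurfaceUniversality` (stmt-CriticalPhenomena-6964) is never junk

`SurfaceUniversality` (item stmt-CriticalPhenomena-6964, route SAWCompassLattice) compares, on
bounded continuous test functions, the critical `ℤ²` SAW law `SAW.law` with the compass chordal
law, the `let law` of the item — *definitionally* `SAW.compassLaw` (`compassLaw_eq_routeLet`;
`surfaceUniversality_iff` below is `Iff.rfl`). The item is an instance of planar SAW universality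
(open). Proved here is the audit fact that its compass side is never junk along the filter of the
statement: under the item's hypotheses (positive fugacities, a Dobrushin domain, a port endpoint
approximation `IsYBEndpointApprox (fun _ => π/2) D a b`) the compass law is a probability measure
for all small `δ > 0` (`eventually_isProbabilityMeasure_compassLaw`):

* the square tiling `Θ ≡ π/2` has corners `planeCorner (k, j) = k + (j - 1/2) i`
  (`planeCorner_rightAngles`), so a bounded domain has finitely many mesh faces
  (`meshFaces_rightAngles_finite`);
* every port on a compass path of positive length is wired to a terminal of a gadget of the path,
  so the self-avoiding compass paths through gadgets of a finite set of faces form a finite set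
  (`finite_compassPaths`) — although ports are not restricted by `compassSupport`;
* all compass fugacities on edges are positive, so every path has positive weight
  (`walkWeight_compassFugacity_pos`);
* a Yang–Baxter walk of `Δ` from `a` to `b` yields a compass path from port `a` to port `b`
  through gadgets of faces of `Δ` (`nonempty_compassPaths_of_ybWalk`: consecutive mid-edges are
  sides of a common face, whose terminals are joined along the outer 8-cycle of its gadget).
-/

noncomputable section

namespace Summit.CriticalPhenomena.SAWScalingLimit.Cruxes.HexTransfer.Sketch.Surface

open MeasureTheory Filter Topology Set
open Literature.Probability.RandomPlanarGeometry
open Literature.Probability.RandomPlanarGeometry.SAW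
open Literature.Probability.RandomPlanarGeometry.SAW.YangBaxter
open scoped ENNReal

/-! ### The square tiling `Θ ≡ π/2` -/

/-- At right angles every column is shifted by `1`. -/
theorem colShift_rightAngles (k : ℤ) : colShift rightAngles k = 1 := by
  simp [colShift, rightAngles]

/-- At right angles the column offset of column `k` is `k`. -/
theorem colOffset_rightAngles (k : ℤ) : colOffset rightAngles k = k := by
  induction k with
  | zero => simp
  | succ n ih =>
    rw [colOffset_add_one, ih, colShift_rightAngles]
    push_cast
    ring
  | pred n ih =>
    have h := colOffset_add_one rightAngles (-(n : ℤ) - 1)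
    rw [sub_add_cancel, colShift_rightAngles, ih] at h
    push_cast at h ⊢
    linear_combination -h

/-- At right angles the lower-left corner of the face `(k, j)` is `k + (j - 1/2) i`. -/
theorem planeCorner_rightAngles (f : Face) :
    planeCorner rightAngles f = (f.1 : ℂ) + ((f.2 : ℂ) * Complex.I - Complex.I / 2) := by
  rw [planeCorner, colOffset_rightAngles]
  ring

/-- **A bounded domain has finitely many mesh faces** (square tiling, mesh `δ > 0`). -/
theorem meshFaces_rightAngles_finite {Ω : Set ℂ} (hΩ : Bornology.IsBounded Ω) {δ : ℝ}
    (hδ : 0 < δ) : (meshFaces rightAngles Ω δ).Finite := by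
  obtain ⟨M, hM⟩ := hΩ.subset_closedBall 0
  obtain ⟨N, hN⟩ := exists_nat_ge (M / δ + 1)
  refine ((Set.finite_Icc (-(N : ℤ)) N).prod (Set.finite_Icc (-(N : ℤ)) N)).subset ?_
  rintro ⟨k, j⟩ hf
  have hc : (δ : ℂ) * planeCorner rightAngles (k, j) ∈ Ω :=
    hf _ (cornerSet_subset_rhombus _ _ (by simp [cornerSet]))
  have hnorm : ‖(δ : ℂ) * planeCorner rightAngles (k, j)‖ ≤ M := by
    simpa using hM hc
  rw [norm_mul, Complex.norm_real, Real.norm_eq_abs, abs_of_pos hδ] at hnorm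
  have hb : ‖planeCorner rightAngles (k, j)‖ ≤ M / δ := by
    rw [le_div_iff₀ hδ]
    linarith
  have hre := (Complex.abs_re_le_norm _).trans hb
  have him := (Complex.abs_im_le_norm _).trans hb
  rw [planeCorner_rightAngles] at hre him
  simp only [Complex.add_re, Complex.intCast_re, Complex.sub_re, Complex.mul_re, Complex.I_re,
    mul_zero, Complex.intCast_im, Complex.I_im, mul_one, sub_self, Complex.div_ofNat_re, zero_div,
    add_zero, Complex.add_im, Complex.sub_im, Complex.mul_im, zero_add,
    Complex.div_ofNat_im] at hre him
  rw [abs_le] at hre him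
  have hN' : (M / δ : ℝ) ≤ N - 1 := by linarith
  simp only [Set.mem_prod, Set.mem_Icc]
  refine ⟨⟨?_, ?_⟩, ?_, ?_⟩
  · have : (-(N : ℝ)) ≤ k := by linarith [hre.1]
    exact_mod_cast this
  · have : (k : ℝ) ≤ N := by linarith [hre.2]
    exact_mod_cast this
  · have : (-(N : ℝ)) ≤ j := by linarith [him.1]
    exact_mod_cast this
  · have : (j : ℝ) ≤ N := by linarith [him.2]
    exact_mod_cast this

/-! ### Finitely many compass paths through a finite set of faces -/

/-- On a compass walk, a port other than the starting vertex is entered from a terminal of a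
gadget of the walk: it is a side of a face carrying a vertex of the walk. -/
theorem port_mem_of_mem_support {Δ : Set Face} {u w : MidEdge ⊕ Face × Fin 3 × Fin 4}
    (p : compassLattice.Walk u w) (hS : ∀ v ∈ p.support, v ∈ PortGadget.inFaces Δ)
    {e : MidEdge} (he : (Sum.inl e : MidEdge ⊕ Face × Fin 3 × Fin 4) ∈ p.support)
    (hne : (Sum.inl e : MidEdge ⊕ Face × Fin 3 × Fin 4) ≠ u) :
    ∃ f ∈ Δ, ∃ s : Side, f.side s = e := by
  rw [SimpleGraph.Walk.mem_support_iff] at he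
  rcases he with he | he
  · exact absurd he hne
  rw [← SimpleGraph.Walk.map_snd_darts, List.mem_map] at he
  obtain ⟨d, hd, hde⟩ := he
  have hadj : compassLattice.Adj d.fst (Sum.inl e) := hde ▸ d.adj
  have hfst := hS _ (SimpleGraph.Walk.dart_fst_mem_support_of_mem_darts p hd)
  revert hadj hfst
  rcases d.fst with e' | ⟨f, l, i⟩
  · simp
  · intro hadj hfst
    rw [compassLattice_adj_inr_inl] at hadj
    exact ⟨f, (PortGadget.inr_mem_inFaces Δ f (l, i)).1 hfst, _, hadj.2⟩

/-- **The self-avoiding compass paths between two ports through gadgets of a finite set of faces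
form a finite set** (ports are unrestricted, but every port of such a path other than its start is
a side of one of the finitely many faces). -/
theorem finite_compassPaths {Δ : Set Face} (hΔ : Δ.Finite) (a b : MidEdge) :
    Finite {p : compassLattice.Walk (Sum.inl a) (Sum.inl b) //
      p.IsPath ∧ ∀ v ∈ p.support, v ∈ PortGadget.inFaces Δ} := by
  classical
  -- the finite set of vertices such a path can visit
  let F : Set (MidEdge ⊕ Face × Fin 3 × Fin 4) :=
    insert (Sum.inl a)
      (((fun q : Face × Side => Sum.inl (q.1.side q.2)) '' (Δ ×ˢ Set.univ)) ∪
        ((fun q : Face × (Fin 3 × Fin 4) => Sum.inr q) '' (Δ ×ˢ Set.univ)))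
  have hF : F.Finite :=
    (((hΔ.prod (Set.toFinite _)).image _).union ((hΔ.prod (Set.toFinite _)).image _)).insert _
  haveI : Fintype F := hF.fintype
  have hsupp : ∀ p : {p : compassLattice.Walk (Sum.inl a) (Sum.inl b) //
      p.IsPath ∧ ∀ v ∈ p.support, v ∈ PortGadget.inFaces Δ},
      ∀ v ∈ p.1.support, v ∈ F := by
    rintro ⟨p, _, hS⟩ (e | ⟨f, q⟩) hv
    · by_cases h : (Sum.inl e : MidEdge ⊕ Face × Fin 3 × Fin 4) = Sum.inl a
      · exact h ▸ Set.mem_insert _ _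
      · obtain ⟨f, hf, s, hs⟩ := port_mem_of_mem_support p hS hv h
        exact Set.mem_insert_of_mem _ (Or.inl ⟨(f, s), ⟨hf, Set.mem_univ _⟩, by simp [hs]⟩)
    · exact Set.mem_insert_of_mem _ (Or.inr
        ⟨(f, q), ⟨(PortGadget.inr_mem_inFaces Δ f q).1 (hS _ hv), Set.mem_univ _⟩, rfl⟩)
  -- supports, as duplicate-free lists over `F`, have bounded length
  let g : {p : compassLattice.Walk (Sum.inl a) (Sum.inl b) //
      p.IsPath ∧ ∀ v ∈ p.support, v ∈ PortGadget.inFaces Δ} →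
      {l : List F // l.length ≤ Fintype.card F} := fun p =>
    ⟨p.1.support.pmap (fun w hw => ⟨w, hw⟩) (hsupp p), by
      rw [List.length_pmap]
      have hnd : (p.1.support.pmap (fun w hw => (⟨w, hw⟩ : F)) (hsupp p)).Nodup := by
        refine List.Nodup.pmap ?_ p.2.1.support_nodup
        intro a _ b _ h
        exact congrArg Subtype.val h
      have := hnd.length_le_card
      rwa [List.length_pmap] at this⟩
  haveI : Finite {l : List F // l.length ≤ Fintype.card F} :=
    (List.finite_length_le _ _).to_subtype
  refine Finite.of_injective g fun p p' h => ?_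
  have h' := congrArg (fun l : {l : List F // l.length ≤ Fintype.card F} => l.1.map Subtype.val) h
  simp only [g, List.map_pmap, List.pmap_eq_map, List.map_id'] at h'
  exact Subtype.ext (SimpleGraph.Walk.support_injective h')

/-! ### Positive weights -/

/-- Every edge of the compass lattice has positive fugacity when `α, β, s, z > 0`. -/
theorem compassFugacity_pos {α β s z : ℝ} (hα : 0 < α) (hβ : 0 < β) (hs : 0 < s)
    (hz : 0 < z) {x x' : MidEdge ⊕ Face × Fin 3 × Fin 4} (h : compassLattice.Adj x x') :
    0 < compassFugacity α β s z x x' := by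
  rcases x with e | ⟨f, l, i⟩ <;> rcases x' with e' | ⟨f', l', i'⟩
  · simp at h
  · exact hz
  · exact hz
  · simp only [compassFugacity]
    split_ifs
    exacts [hα, hs, hβ]

/-- Every compass walk has positive weight when `α, β, s, z > 0`. -/
theorem walkWeight_compassFugacity_pos {α β s z : ℝ} (hα : 0 < α) (hβ : 0 < β) (hs : 0 < s)
    (hz : 0 < z) {u v : MidEdge ⊕ Face × Fin 3 × Fin 4} (p : compassLattice.Walk u v) :
    0 < PortGadget.walkWeight (compassFugacity α β s z) p := by
  induction p with
  | nil => simp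
  | cons h p ih =>
    rw [PortGadget.walkWeight_cons]
    exact mul_pos (compassFugacity_pos hα hβ hs hz h) ih

/-! ### A Yang–Baxter walk yields a compass path -/

/- We work in the compass lattice restricted to the ports and the gadgets of the faces of `Δ`,
`compassLattice.induce (PortGadget.inFaces Δ)`, with vertices the ports
`⟨.inl e, inl_mem_inFaces Δ e⟩` and the gadget vertices `⟨.inr (f, q), _⟩`, `f ∈ Δ`. -/

/-- Along the outer cycle: terminal `Q_i` reaches `Q_{i+1}` through `A_i`. -/
theorem reachable_terminal_succ {Δ : Set Face} {f : Face} (hf : f ∈ Δ) (i : Fin 4) :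
    (compassLattice.induce (PortGadget.inFaces Δ)).Reachable
      ⟨Sum.inr (f, (0, i)), (PortGadget.inr_mem_inFaces Δ f _).2 hf⟩
      ⟨Sum.inr (f, (0, i + 1)), (PortGadget.inr_mem_inFaces Δ f _).2 hf⟩ := by
  have h1 : (compassLattice.induce (PortGadget.inFaces Δ)).Adj
      ⟨Sum.inr (f, (0, i)), (PortGadget.inr_mem_inFaces Δ f _).2 hf⟩
      ⟨Sum.inr (f, (1, i)), (PortGadget.inr_mem_inFaces Δ f _).2 hf⟩ := by
    rw [SimpleGraph.induce_adj, compassLattice_adj_inr_inr, compassGadgetGraph_adj]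
    refine ⟨rfl, by simp, Or.inl (Or.inl ⟨rfl, rfl, Or.inl rfl⟩)⟩
  have h2 : (compassLattice.induce (PortGadget.inFaces Δ)).Adj
      ⟨Sum.inr (f, (1, i)), (PortGadget.inr_mem_inFaces Δ f _).2 hf⟩
      ⟨Sum.inr (f, (0, i + 1)), (PortGadget.inr_mem_inFaces Δ f _).2 hf⟩ := by
    rw [SimpleGraph.induce_adj, compassLattice_adj_inr_inr, compassGadgetGraph_adj]
    refine ⟨rfl, by simp, Or.inr (Or.inl ⟨rfl, rfl, Or.inr rfl⟩)⟩
  exact h1.reachable.trans h2.reachable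

/-- Inside one gadget the terminal `Q_0` reaches every terminal. -/
theorem reachable_terminal_zero {Δ : Set Face} {f : Face} (hf : f ∈ Δ) (i : Fin 4) :
    (compassLattice.induce (PortGadget.inFaces Δ)).Reachable
      ⟨Sum.inr (f, (0, 0)), (PortGadget.inr_mem_inFaces Δ f _).2 hf⟩
      ⟨Sum.inr (f, (0, i)), (PortGadget.inr_mem_inFaces Δ f _).2 hf⟩ := by
  induction i using Fin.induction with
  | zero => rfl
  | succ i ih =>
    have := ih.trans (reachable_terminal_succ hf i.castSucc)
    rwa [Fin.coeSucc_eq_succ] at this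

/-- Inside one gadget every terminal reaches every terminal. -/
theorem reachable_terminal {Δ : Set Face} {f : Face} (hf : f ∈ Δ) (i j : Fin 4) :
    (compassLattice.induce (PortGadget.inFaces Δ)).Reachable
      ⟨Sum.inr (f, (0, i)), (PortGadget.inr_mem_inFaces Δ f _).2 hf⟩
      ⟨Sum.inr (f, (0, j)), (PortGadget.inr_mem_inFaces Δ f _).2 hf⟩ :=
  (reachable_terminal_zero hf i).symm.trans (reachable_terminal_zero hf j)

/-- A mid-edge bordering a face is one of its sides. -/
theorem exists_side_eq {e : MidEdge} {f : Face} (h : f = e.faces.1 ∨ f = e.faces.2) :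
    ∃ s : Side, f.side s = e := by
  obtain ⟨h1, h2⟩ := eq_side_faces e
  rcases h with rfl | rfl
  · rcases h1 with h1 | h1
    exacts [⟨_, h1.symm⟩, ⟨_, h1.symm⟩]
  · rcases h2 with h2 | h2
    exacts [⟨_, h2.symm⟩, ⟨_, h2.symm⟩]

/-- A port on a side of a face of `Δ` is adjacent to the corresponding terminal. -/
theorem adj_port_terminal {Δ : Set Face} {f : Face} (hf : f ∈ Δ) {e : MidEdge} {s : Side}
    (hs : f.side s = e) :
    (compassLattice.induce (PortGadget.inFaces Δ)).Adj
      ⟨Sum.inl e, PortGadget.inl_mem_inFaces Δ e⟩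
      ⟨Sum.inr (f, (0, (compassTerm s).2)), (PortGadget.inr_mem_inFaces Δ f _).2 hf⟩ := by
  rw [SimpleGraph.induce_adj, compassLattice_adj_inl_inr, compassCyc_compassTerm_snd]
  exact ⟨rfl, hs⟩

/-- Two mid-edges with a common face in `Δ` are joined through the gadget of that face. -/
theorem reachable_of_commonFace {Δ : Set Face} {e e' : MidEdge} {f : Face} (hf : f ∈ Δ)
    (h : MidEdge.commonFace e e' = some f) :
    (compassLattice.induce (PortGadget.inFaces Δ)).Reachable
      ⟨Sum.inl e, PortGadget.inl_mem_inFaces Δ e⟩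
      ⟨Sum.inl e', PortGadget.inl_mem_inFaces Δ e'⟩ := by
  obtain ⟨h1, h2⟩ := eq_faces_of_commonFace h
  obtain ⟨s, hs⟩ := exists_side_eq h1
  obtain ⟨s', hs'⟩ := exists_side_eq h2
  exact ((adj_port_terminal hf hs).reachable.trans
    (reachable_terminal hf (compassTerm s).2 (compassTerm s').2)).trans
      (adj_port_terminal hf hs').reachable.symm

/-- The two ends of a chain of mid-edges whose consecutive pairs share faces of `Δ` are joined in
the restricted compass lattice. -/
theorem reachable_of_arcs {Δ : Set Face} :
    ∀ (l : List MidEdge) (e e' : MidEdge), l.head? = some e → l.getLast? = some e' →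
      (∀ p ∈ arcsOf l, ∃ f ∈ Δ, arcFace p = some f) →
        (compassLattice.induce (PortGadget.inFaces Δ)).Reachable
          ⟨Sum.inl e, PortGadget.inl_mem_inFaces Δ e⟩
          ⟨Sum.inl e', PortGadget.inl_mem_inFaces Δ e'⟩
  | [], e, e', hh, _, _ => by simp at hh
  | [x], e, e', hh, hl, _ => by
    simp only [List.head?_cons, Option.some.injEq, List.getLast?_singleton] at hh hl
    subst hh hl
    rfl
  | x :: y :: l, e, e', hh, hl, harc => by
    simp only [List.head?_cons, Option.some.injEq] at hh
    subst hh
    have hxy : ∃ f ∈ Δ, arcFace (x, y) = some f := harc (x, y) (by simp [arcsOf])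
    obtain ⟨f, hf, hfxy⟩ := hxy
    have ih := reachable_of_arcs (y :: l) y e' rfl (by simpa [List.getLast?_cons_cons] using hl)
      (fun p hp => harc p (by
        simp only [arcsOf, List.tail_cons, List.zip_cons_cons, List.mem_cons] at hp ⊢
        exact Or.inr hp))
    exact (reachable_of_commonFace hf hfxy).trans ih

/-- **A Yang–Baxter walk of `Δ` from `a` to `b` yields a self-avoiding compass path from port `a`
to port `b` through gadgets of faces of `Δ`.** -/
theorem nonempty_compassPaths_of_ybWalk {Δ : Set Face} {a b : MidEdge} (γ : YBWalk Δ a b) :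
    Nonempty {p : compassLattice.Walk (Sum.inl a) (Sum.inl b) //
      p.IsPath ∧ ∀ v ∈ p.support, v ∈ PortGadget.inFaces Δ} := by
  classical
  obtain ⟨q⟩ := reachable_of_arcs γ.mids a b γ.head_eq γ.getLast_eq γ.arc_mem
  let φ : compassLattice.induce (PortGadget.inFaces Δ) ↪g compassLattice :=
    SimpleGraph.Embedding.induce _
  have key : ∀ v ∈ (q.bypass.map φ.toHom).support, v ∈ PortGadget.inFaces Δ := by
    intro v hv
    rw [SimpleGraph.Walk.support_map, List.mem_map] at hv
    obtain ⟨w, -, rfl⟩ := hv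
    exact w.2
  exact ⟨⟨q.bypass.map φ.toHom, q.bypass_isPath.map φ.injective, key⟩⟩

/-! ### The compass law is a probability measure -/

/-- The total mass of the compass measure is the sum of the weights of the admissible paths. -/
theorem compassMeasure_univ (α β s z : ℝ) (Ω : Set ℂ) (δ : ℝ) (a b : MidEdge) :
    compassMeasure α β s z Ω δ a b Set.univ =
      ∑' p : {p : compassLattice.Walk (Sum.inl a) (Sum.inl b) //
        p.IsPath ∧ ∀ v ∈ p.support, v ∈ compassSupport Ω δ},
        ENNReal.ofReal (PortGadget.walkWeight (compassFugacity α β s z) p.1) := by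
  rw [compassMeasure, PortGadget.pathMeasure, Measure.sum_apply _ MeasurableSet.univ]
  simp

/-- **The compass law of a bounded domain is a probability measure** as soon as `δ > 0`, the
fugacities are positive and some Yang–Baxter walk of `Ω_δ` joins `a` to `b`: the partition
function is positive (a compass path exists, all weights are positive) and finite (finitely many
paths). -/
theorem isProbabilityMeasure_compassLaw {α β s z : ℝ} (hα : 0 < α) (hβ : 0 < β) (hs : 0 < s)
    (hz : 0 < z) {Ω : Set ℂ} (hΩ : Bornology.IsBounded Ω) {δ : ℝ} (hδ : 0 < δ)
    {a b : MidEdge} (hne : Nonempty (YangBaxterSAW rightAngles Ω δ a b)) :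
    IsProbabilityMeasure (compassLaw α β s z Ω δ a b) := by
  classical
  haveI hfin : Finite {p : compassLattice.Walk (Sum.inl a) (Sum.inl b) //
      p.IsPath ∧ ∀ v ∈ p.support, v ∈ compassSupport Ω δ} :=
    finite_compassPaths (meshFaces_rightAngles_finite hΩ hδ) a b
  haveI : Fintype {p : compassLattice.Walk (Sum.inl a) (Sum.inl b) //
      p.IsPath ∧ ∀ v ∈ p.support, v ∈ compassSupport Ω δ} := Fintype.ofFinite _
  obtain ⟨γ⟩ := hne
  obtain ⟨p⟩ := nonempty_compassPaths_of_ybWalk γ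
  have h0 : compassMeasure α β s z Ω δ a b Set.univ ≠ 0 := by
    rw [compassMeasure_univ]
    refine fun h => ?_
    have hp := ENNReal.le_tsum (f := fun p : {p : compassLattice.Walk (Sum.inl a) (Sum.inl b) //
        p.IsPath ∧ ∀ v ∈ p.support, v ∈ compassSupport Ω δ} =>
      ENNReal.ofReal (PortGadget.walkWeight (compassFugacity α β s z) p.1)) p
    rw [h, nonpos_iff_eq_zero, ENNReal.ofReal_eq_zero] at hp
    exact absurd hp (not_le.2 (walkWeight_compassFugacity_pos hα hβ hs hz p.1))
  have htop : compassMeasure α β s z Ω δ a b Set.univ ≠ ⊤ := by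
    rw [compassMeasure_univ, tsum_fintype]
    exact ENNReal.sum_ne_top.2 fun _ _ => ENNReal.ofReal_ne_top
  refine ⟨?_⟩
  change (compassMeasure α β s z Ω δ a b Set.univ)⁻¹ •
    compassMeasure α β s z Ω δ a b Set.univ = 1
  rw [smul_eq_mul, ENNReal.inv_mul_cancel h0 htop]

/-- **Non-vacuity of the compass side of `SurfaceUniversality` / `CompassSLE`.** For positive
fugacities, a Dobrushin domain `D` and a port endpoint approximation `(a, b)` at `Θ ≡ π/2`, the
compass chordal law `compassLaw α β s z D.carrier δ (a δ) (b δ)` — definitionally the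
`let law` of items stmt-CriticalPhenomena-6964/6965 (`compassLaw_eq_routeLet`) — is a
probability measure for all small `δ > 0`; in particular its junk value `0` is eventually
excluded. -/
theorem eventually_isProbabilityMeasure_compassLaw {α β s z : ℝ} (hα : 0 < α) (hβ : 0 < β)
    (hs : 0 < s) (hz : 0 < z) (D : DobrushinDomain) {a b : ℝ → MidEdge}
    (h : IsYBEndpointApprox rightAngles D a b) :
    ∀ᶠ δ in 𝓝[>] (0 : ℝ),
      IsProbabilityMeasure (compassLaw α β s z D.carrier δ (a δ) (b δ)) := by
  filter_upwards [h.nonempty, self_mem_nhdsWithin] with δ hne hδ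
  exact isProbabilityMeasure_compassLaw hα hβ hs hz D.isBounded hδ hne

/-! ### The item `SurfaceUniversality`, with its `let` chain named -/

/-- **`SurfaceUniversality` de-`let`-ed**: the item stmt-CriticalPhenomena-6964 is, definitionally,
the statement that for every solution of the compass equations (`IsCompassSolution`), every
Dobrushin domain, every `ℤ²` endpoint approximation and every port endpoint approximation at
`Θ ≡ π/2`, the difference of the test integrals of the critical `ℤ²` SAW law and of
`compassLaw α β s z` tends to `0` along `δ → 0⁺`. -/
theorem surfaceUniversality_iff :
    Theses.SAWCompassLattice.SurfaceUniversality ↔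
      ∀ (α β s z : ℝ), IsCompassSolution α β s z →
        ∀ (D : DobrushinDomain) (a b : ℝ → Literature.Probability.LatticeModels.Site 2)
          (a' b' : ℝ → MidEdge), SAW.IsEndpointApprox D a b →
          IsYBEndpointApprox rightAngles D a' b' →
            ∀ f : BoundedContinuousFunction (CurveClass ℂ) ℝ,
              Tendsto (fun δ => (∫ γ, f γ.curve ∂(SAW.law D.carrier δ (a δ) (b δ))) -
                ∫ x, f x ∂(compassLaw α β s z D.carrier δ (a' δ) (b' δ)))
                (𝓝[>] (0 : ℝ)) (𝓝 0) :=
  Iff.rfl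

/-- **The compass term of `SurfaceUniversality` is an honest expectation, eventually.** Under the
hypotheses of the item (a solution of the compass equations, a port endpoint approximation), the
compass law integrated against in stmt-CriticalPhenomena-6964 is a probability measure for all
small `δ > 0` (so e.g. for a constant test function `f ≡ c` the compass integral is eventually
`c`, matching the `ℤ²` side, whose law is likewise eventually a probability measure under
`SAW.IsEndpointApprox`). -/
theorem eventually_isProbabilityMeasure_compassLaw_of_isCompassSolution {α β s z : ℝ}
    (hsol : IsCompassSolution α β s z) (D : DobrushinDomain) {a' b' : ℝ → MidEdge}
    (h : IsYBEndpointApprox rightAngles D a' b') :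
    ∀ᶠ δ in 𝓝[>] (0 : ℝ),
      IsProbabilityMeasure (compassLaw α β s z D.carrier δ (a' δ) (b' δ)) :=
  eventually_isProbabilityMeasure_compassLaw hsol.1 hsol.2.1 hsol.2.2.1 hsol.2.2.2.1 D h

end Summit.CriticalPhenomena.SAWScalingLimit.Cruxes.HexTransfer.Sketch.Surface

end
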